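import Literature.NumberTheory.Automorphic.LocalConstants
import Literature.NumberTheory.GaloisRepresentations.LocalFieldProofs
import HarnessLib

/-!
# Unramified twists shift `s`: proof of the named fact `epsilonWD_tprod_unramified`

This sibling file of `Literature.NumberTheory.Automorphic.LocalConstants` discharges the named
fact `Literature.NumberTheory.Automorphic.epsilonWD_tprod_unramified` (Tate, *Number theoretic
background*, Corvallis 1979, (3.4.5), (4.1.6); Deligne, Antwerp II (1973), (5.5.3), §8.12):
for a complex Weil–Deligne representation `r = (ρ, N)` of `W_F`, a local Artin datum `d`, the
unramified quasi-character `ω_t = |·|_F^t` and the `ε`-factor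
`ε((ρ, N), s, ψ, μ) = ε₀(ρ ⊗ ‖·‖^s, ψ, μ) · det(-Φ q^{-s} | V^{I} ⧸ (ker N)^{I})` of
`LocalConstants` (`epsilonWD`),
`ε((ρ, N) ⊗ (ω_t ∘ artin_d), s, ψ, μ) = ε((ρ, N), s + t, ψ, μ)`,
as `theorem epsilonWD_tprod_unramified_holds`.  The file contains theorems only (no new
definitions, no new named facts); the other named facts of `LocalConstants` are discharged in
`LocalConstantsProofs.lean` (`frobDetFactor_eq_holds`,
`WeilGroup.exists_subgroup_le_inertia_isOpen_of_continuous_holds`).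

## The argument

The arithmetic input is `|artin_d w|_F = ‖w‖ = q ^ deg w` for every `w ∈ W_F`
(`EpsilonTwist.normAbs_artin`): `artin_d` maps inertia into `𝒪ˣ` (`LocalArtinData.image_inertia`)
and a geometric Frobenius `Φ` (`deg Φ = -1`) to a uniformiser (`LocalArtinData.artin_frob`), of
absolute value `q⁻¹` (`normAbs_uniformizer_holds` of `LocalFieldProofs`); write `w = Φ^{-deg w} u`
with `u ∈ I_F`.  Hence `ω_t ∘ artin_d = ‖·‖^t` on `W_F` (`EpsilonTwist.unramifiedTwist_artin`).

* `ε₀`-part.  Along `V ⊗ ℂ ≃ V` (`TensorProduct.rid`) the Weil–Deligne representation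
  `(r ⊗ (ω_t ∘ artin)) ⊗ ‖·‖^s = (‖·‖^s (ρ ⊗ ω_t), N ⊗ 1 + 1 ⊗ 0)` is isomorphic to
  `r ⊗ ‖·‖^{s+t} = (‖·‖^{s+t} ρ, N)` (`EpsilonTwist.isEquivalent_tprod_unramifiedTwist`), and `ε₀`
  is an isomorphism invariant (`LocalEpsilonSystem.equiv`).
* Determinant part.  More generally, if `e : V ≃ V'` satisfies `ρ'(w) ∘ e = c(w) • e ∘ ρ(w)` and
  `N' ∘ e = e ∘ N` with `c = 1` on inertia, then `e` identifies `V^I`, `(ker N)^I` with `V'^I`,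
  `(ker N')^I`, the induced isomorphism of `V^I ⧸ (ker N)^I` conjugates the action of `w` up to
  `c(w)`, and `det(-(a w) | V'^I ⧸ …) = det(-(a c(w) w) | V^I ⧸ …)` by conjugation invariance of
  `LinearMap.det` (`EpsilonTwist.det_neg_smul_inertiaQuotEnd_eq_of_conj`).  For
  `r' = r ⊗ (χ ∘ artin)`, `χ` unramified, `e = (V ≃ V ⊗ ℂ)`, `c = χ ∘ artin`
  (`EpsilonTwist.frobDetFactor_tprod_ofQuasiChar`), and for `χ = ω_t`,
  `q^{-s} ‖Φ‖^t = q^{-s} q^{-t} = q^{-(s+t)}` (`EpsilonTwist.qpow_mul_normCpow_geomFrob`).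

## References

* J. Tate, *Number theoretic background*, Proc. Sympos. Pure Math. 33 (Corvallis 1977), Part 2,
  AMS (1979), 3–26: (1.4.1), (1.4.6) (`‖w‖`, the Artin map), (2.2), (3.4.5), (4.1.6)
  (`ε(V, s)` of a representation of the Weil–Deligne group). [TateCorvallis1979]
* P. Deligne, *Les constantes des équations fonctionnelles des fonctions L*, Antwerp II, LNM 349
  (1973), §2.3, (5.5.3), §8.12. [DeligneAntwerpII1973]
* S. Kudla, *Tate's thesis*, in: An Introduction to the Langlands Program (Bernstein–Gelbart,
  eds.), Birkhäuser 2003, §3, (3.28): the `GL₁` case `ε(s, ω ω_t, ψ) = ε(s + t, ω, ψ)`.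
-/

noncomputable section

open scoped NNReal TensorProduct
open Module MeasureTheory ValuativeRel

namespace Literature.NumberTheory.Automorphic

/-! ### `|artin w|_F = ‖w‖` -/

namespace EpsilonTwist

open GaloisRepresentations GaloisRepresentations.IsNonarchimedeanLocalField
  GaloisRepresentations.WeilGroup GaloisRepresentations.WeilDeligneRep

variable {F : Type*} [Field F] [ValuativeRel F] [TopologicalSpace F] [IsNonarchimedeanLocalField F]

/-- The local Artin map sends inertia to units: `|artin u|_F = 1` for `u ∈ I_F`.
Ref: Tate, Corvallis 1979, (1.4.1). [folklore] -/
theorem normAbs_artin_of_mem_inertia (d : LocalArtinData F) {u : WeilGroup F}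
    (hu : u ∈ inertia F) : normAbs F (d.artin u : F) = 1 := by
  have h : d.artin u ∈ (valuation F).valuationSubring.unitGroup := by
    rw [← d.image_inertia]
    exact Subgroup.mem_map_of_mem _ hu
  rw [Valuation.mem_unitGroup_iff] at h
  rw [normAbs_apply, h, map_one, map_one]

/-- `deg (w ^ n) = n * deg w`. [folklore] -/
theorem deg_zpow (hmul : IsFrobPow.mul (F := F)) (huniq : IsFrobPow.unique (F := F))
    (w : WeilGroup F) (n : ℤ) : deg (w ^ n) = n * deg w := by
  have h := map_zpow (degHom F hmul huniq) w n
  simp only [degHom_apply] at h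
  apply Multiplicative.ofAdd.injective
  rw [h, ← ofAdd_zsmul, smul_eq_mul]

/-- **`|artin w|_F = ‖w‖`**: the local Artin map (Deligne's normalisation: geometric Frobenius ↦
uniformiser, inertia ↦ units) is compatible with the norms, `|artin w|_F = q ^ deg w`.
Ref: Tate, Corvallis 1979, (1.4.1), (1.4.6); Deligne, Antwerp II (1973), §2.3. [folklore] -/
theorem normAbs_artin (hmul : IsFrobPow.mul (F := F)) (huniq : IsFrobPow.unique (F := F))
    (hex : exists_isFrobPow (F := F)) (d : LocalArtinData F) (w : WeilGroup F) :
    ((normAbs F (d.artin w : F) : ℝ≥0) : ℝ) = WeilGroup.norm w := by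
  set Φ := geomFrob F hex
  have hΦ : deg Φ = -1 := deg_geomFrob hmul huniq hex
  have hu : Φ ^ deg w * w ∈ inertia F := by
    rw [← deg_eq_zero_iff_mem_inertia hmul huniq, deg_mul hmul huniq, deg_zpow hmul huniq, hΦ]
    ring
  have hw : w = Φ ^ (-deg w) * (Φ ^ deg w * w) := by
    rw [← mul_assoc, ← zpow_add, neg_add_cancel, zpow_zero, one_mul]
  calc ((normAbs F (d.artin w : F) : ℝ≥0) : ℝ)
      = ((normAbs F (d.artin (Φ ^ (-deg w) * (Φ ^ deg w * w)) : F) : ℝ≥0) : ℝ) := by rw [← hw]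
    _ = ((normAbs F (d.artin Φ : F) : ℝ≥0) : ℝ) ^ (-deg w) *
          ((normAbs F (d.artin (Φ ^ deg w * w) : F) : ℝ≥0) : ℝ) := by
        rw [map_mul, map_zpow, Units.val_mul, Units.val_zpow_eq_zpow_val, map_mul, map_zpow₀]
        push_cast
        ring
    _ = ((residueFieldCard F : ℝ)⁻¹) ^ (-deg w) * 1 := by
        rw [normAbs_uniformizer_holds (d.artin_frob Φ hΦ), normAbs_artin_of_mem_inertia d hu]
        push_cast
        ring
    _ = WeilGroup.norm w := by rw [norm_def, mul_one, inv_zpow', neg_neg]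

/-- The unramified quasi-character `ω_t = |·|_F^t` pulled back along any local Artin map is
`‖·‖^t` on `W_F`: `ω_t (artin w) = ‖w‖ ^ t = WeilGroup.normCpow t w`.
Ref: Tate, Corvallis 1979, (1.4.6), (2.2). [folklore] -/
theorem unramifiedTwist_artin (hmul : IsFrobPow.mul (F := F)) (huniq : IsFrobPow.unique (F := F))
    (hex : exists_isFrobPow (F := F)) (d : LocalArtinData F) (t : ℂ) (w : WeilGroup F) :
    ((unramifiedTwist F t (d.artin w) : ℂˣ) : ℂ) = normCpow hmul huniq t w := by
  rw [unramifiedTwist_apply, normAbs_artin hmul huniq hex d w, normCpow_apply]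

/-! ### Transport of the Frobenius determinant factor along an isomorphism up to a scalar -/

section Conj

variable {C : Type*} [Field C] [CharZero C] {V : Type*} [AddCommGroup V] [Module C V]
  {V' : Type*} [AddCommGroup V'] [Module C V']

/-- **Transport of `det(-a·w | V^I ⧸ (ker N)^I)`.**  Let `e : V ≃ V'` intertwine the monodromies
of two Weil–Deligne representations `r`, `r'` and intertwine `ρ`, `ρ'` up to a scalar function `c`
on `W_F` that is trivial on inertia: `ρ'(w) (e v) = c(w) • e (ρ(w) v)`, `N' (e v) = e (N v)`
(examples: an isomorphism, `c = 1`; `r' = r ⊗ χ` for an unramified character `χ`, along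
`V ≃ V ⊗ C`, `c = χ`).  Then `e` identifies `V^{I}` with `V'^{I}` and `(ker N)^{I}` with
`(ker N')^{I}`, the induced isomorphism of the quotients conjugates the action of `w` up to
`c(w)`, and hence, by conjugation invariance of `LinearMap.det`, for every scalar `a`,
`det (-(a • w) | V'^I ⧸ (ker N')^I) = det (-((a c(w)) • w) | V^I ⧸ (ker N)^I)`. [folklore] -/
theorem det_neg_smul_inertiaQuotEnd_eq_of_conj (hn : absInertia_normal F)
    (r : WeilDeligneRep F C V) (r' : WeilDeligneRep F C V') (e : V ≃ₗ[C] V')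
    (c : WeilGroup F → C) (hρ : ∀ (w : WeilGroup F) (v : V), r'.ρ w (e v) = c w • e (r.ρ w v))
    (hc : ∀ u ∈ inertia F, c u = 1) (hN : ∀ v : V, r'.N (e v) = e (r.N v))
    (w : WeilGroup F) (a : C) :
    LinearMap.det (-(a • r'.inertiaQuotEnd hn w)) =
      LinearMap.det (-((a * c w) • r.inertiaQuotEnd hn w)) := by
  -- `e` identifies the inertia invariants
  have hmem : ∀ v : V, e v ∈ r'.inertiaInvariants ↔ v ∈ r.inertiaInvariants := fun v => by
    simp only [WeilDeligneRep.mem_inertiaInvariants_iff]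
    refine forall₂_congr fun u hu => ?_
    rw [hρ, hc u hu, one_smul, e.injective.eq_iff]
  have hcomap : r'.inertiaInvariants.comap (e : V →ₗ[C] V') = r.inertiaInvariants :=
    Submodule.ext hmem
  set eI : r.inertiaInvariants ≃ₗ[C] r'.inertiaInvariants :=
    (LinearEquiv.ofEq _ _ hcomap.symm).trans (e.ofSubmodule' r'.inertiaInvariants)
  have heI : ∀ x : r.inertiaInvariants, (eI x : V') = e x := fun x => rfl
  have heI' : ∀ y : r'.inertiaInvariants, e ((eI.symm y : r.inertiaInvariants) : V) = y :=
    fun y => by rw [← heI, LinearEquiv.apply_symm_apply]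
  -- `e` maps `(ker N)^I` onto `(ker N')^I`
  have hmap : r.kerNInertiaInvariants.map (eI : r.inertiaInvariants →ₗ[C] r'.inertiaInvariants) =
      r'.kerNInertiaInvariants := by
    ext y
    simp only [Submodule.mem_map, WeilDeligneRep.kerNInertiaInvariants, Submodule.mem_comap,
      Submodule.subtype_apply, WeilDeligneRep.mem_inertiaInvariantsKerN_iff, LinearEquiv.coe_coe]
    constructor
    · rintro ⟨x, ⟨hx1, -⟩, rfl⟩
      refine ⟨?_, (WeilDeligneRep.mem_inertiaInvariants_iff _ _).mp (eI x).2⟩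
      rw [heI, hN, hx1, map_zero]
    · rintro ⟨hy1, -⟩
      refine ⟨eI.symm y, ⟨?_, ?_⟩, LinearEquiv.apply_symm_apply _ _⟩
      · apply e.injective
        rw [← hN, heI', hy1, map_zero]
      · exact (WeilDeligneRep.mem_inertiaInvariants_iff _ _).mp (eI.symm y).2
  -- the induced isomorphism of the quotients conjugates the actions of `w` up to `c w`
  set E : (r.inertiaInvariants ⧸ r.kerNInertiaInvariants) ≃ₗ[C]
      (r'.inertiaInvariants ⧸ r'.kerNInertiaInvariants) :=
    Submodule.Quotient.equiv _ _ eI hmap with hEdef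
  have hconj : (r'.inertiaQuotEnd hn w) ∘ₗ (E : _ →ₗ[C] _) =
      c w • ((E : _ →ₗ[C] _) ∘ₗ r.inertiaQuotEnd hn w) := by
    refine Submodule.linearMap_qext _ (LinearMap.ext fun x => ?_)
    simp only [LinearMap.comp_apply, Submodule.mkQ_apply, LinearMap.smul_apply, LinearEquiv.coe_coe,
      hEdef, Submodule.Quotient.equiv_apply, WeilDeligneRep.inertiaQuotEnd, Submodule.mapQ_apply,
      ← Submodule.Quotient.mk_smul]
    congr 1
    apply Subtype.ext
    exact hρ w x
  -- determinants
  have hdet : ∀ b : C, LinearMap.det (b • r'.inertiaQuotEnd hn w) =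
      LinearMap.det ((b * c w) • r.inertiaQuotEnd hn w) := fun b => by
    have h1 : (b • r'.inertiaQuotEnd hn w) ∘ₗ (E : _ →ₗ[C] _) =
        (E : _ →ₗ[C] _) ∘ₗ ((b * c w) • r.inertiaQuotEnd hn w) := by
      rw [LinearMap.smul_comp, hconj, smul_smul, LinearMap.comp_smul]
    have h2 : b • r'.inertiaQuotEnd hn w =
        (E : _ →ₗ[C] _) ∘ₗ ((b * c w) • r.inertiaQuotEnd hn w) ∘ₗ (E.symm : _ →ₗ[C] _) := by
      rw [← LinearMap.comp_assoc, LinearEquiv.eq_comp_toLinearMap_symm]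
      exact h1
    rw [h2, LinearMap.det_conj]
  calc LinearMap.det (-(a • r'.inertiaQuotEnd hn w))
      = LinearMap.det ((-a) • r'.inertiaQuotEnd hn w) :=
        DFunLike.congr_arg LinearMap.det (neg_smul a (r'.inertiaQuotEnd hn w)).symm
    _ = LinearMap.det ((-a * c w) • r.inertiaQuotEnd hn w) := hdet (-a)
    _ = LinearMap.det (-((a * c w) • r.inertiaQuotEnd hn w)) := by
        rw [neg_mul]
        exact DFunLike.congr_arg LinearMap.det (neg_smul (a * c w) (r.inertiaQuotEnd hn w))

end Conj

/-! ### Tensoring with an unramified character -/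

section Tprod

variable {V : Type*} [AddCommGroup V] [Module ℂ V]

/-- **The Frobenius determinant factor of `r ⊗ (χ ∘ artin)`, `χ` an unramified quasi-character**:
`det(-q^{-s} Φ | (V ⊗ χ)^I ⧸ (ker N)^I) = det(-(q^{-s} χ(artin Φ)) Φ | V^I ⧸ (ker N)^I)`: along
`V ≃ V ⊗ ℂ` (`TensorProduct.rid`), `ρ ⊗ χ` is `ρ` up to the scalar `χ ∘ artin`, which is trivial on
inertia since `artin (I_F) = 𝒪ˣ` (`det_neg_smul_inertiaQuotEnd_eq_of_conj`).
Ref: Tate, Corvallis 1979, (4.1.6); Deligne, Antwerp II (1973), §8.12. [folklore] -/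
theorem frobDetFactor_tprod_ofQuasiChar
    (hn : absInertia_normal F) (hex : exists_isFrobPow (F := F))
    (hns : WeilGroup.exists_subgroup_le_inertia_isOpen_of_continuous (F := F))
    (r : WeilDeligneRep F ℂ V) (d : LocalArtinData F) {χ : QuasiChar F} (hχ : χ.IsUnramified)
    (s : ℂ) :
    (r.tprod (WeilDeligneRep.ofQuasiChar hns d χ)).frobDetFactor hn hex s =
      LinearMap.det (-((((residueFieldCard F : ℂ) ^ (-s)) *
        ((χ (d.artin (geomFrob F hex)) : ℂˣ) : ℂ)) • r.inertiaQuotEnd hn (geomFrob F hex))) := by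
  rw [WeilDeligneRep.frobDetFactor]
  refine det_neg_smul_inertiaQuotEnd_eq_of_conj hn r _ (TensorProduct.rid ℂ V).symm
    (fun w => ((χ (d.artin w) : ℂˣ) : ℂ)) (fun w v => ?_) (fun u hu => ?_) (fun v => ?_) _ _
  · simp only [TensorProduct.rid_symm_apply, WeilDeligneRep.tprod_ρ_apply, TensorProduct.map_tmul,
      WeilDeligneRep.ofQuasiChar_ρ_apply, mul_one]
    rw [TensorProduct.smul_tmul', TensorProduct.smul_tmul, smul_eq_mul, mul_one]
  · rw [hχ _ (normAbs_artin_of_mem_inertia d hu), Units.val_one]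
  · simp only [TensorProduct.rid_symm_apply, WeilDeligneRep.tprod_N, LinearMap.add_apply,
      TensorProduct.map_tmul, WeilDeligneRep.ofQuasiChar_N, LinearMap.zero_apply,
      TensorProduct.tmul_zero, add_zero, Module.End.one_apply]

end Tprod

/-! ### The isomorphism `(r ⊗ ω_t) ⊗ ω_s ≅ r ⊗ ω_{s+t}` -/

section Twist

variable {V : Type*} [AddCommGroup V] [Module ℂ V]

/-- `‖w‖^(s+t) = ‖w‖^s ‖w‖^t` (`Complex.cpow_add`, `‖w‖ > 0`). [folklore] -/
theorem normCpow_add (hmul : IsFrobPow.mul (F := F)) (huniq : IsFrobPow.unique (F := F))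
    (s t : ℂ) (w : WeilGroup F) :
    normCpow hmul huniq (s + t) w = normCpow hmul huniq s w * normCpow hmul huniq t w := by
  simp only [normCpow_apply]
  exact Complex.cpow_add _ _ (by exact_mod_cast (norm_pos w).ne')

/-- `q^{-s} ‖Φ‖^t = q^{-(s+t)}` for a geometric Frobenius `Φ` (`‖Φ‖ = q⁻¹`). [folklore] -/
theorem qpow_mul_normCpow_geomFrob (hmul : IsFrobPow.mul (F := F))
    (huniq : IsFrobPow.unique (F := F)) (hex : exists_isFrobPow (F := F)) (s t : ℂ) :
    (residueFieldCard F : ℂ) ^ (-s) * normCpow hmul huniq t (geomFrob F hex) =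
      (residueFieldCard F : ℂ) ^ (-(s + t)) := by
  have hq : (residueFieldCard F : ℂ) ≠ 0 := by exact_mod_cast residueFieldCard_ne_zero F
  rw [normCpow_apply, norm_def, deg_geomFrob hmul huniq hex, zpow_neg_one, Complex.ofReal_inv,
    Complex.ofReal_natCast, Complex.inv_cpow _ _ (by rw [Complex.natCast_arg]; exact Real.pi_pos.ne),
    ← Complex.cpow_neg, ← Complex.cpow_add _ _ hq, neg_add]

/-- **`(r ⊗ (ω_t ∘ artin)) ⊗ ‖·‖^s ≅ r ⊗ ‖·‖^{s+t}`** as Weil–Deligne representations, along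
`V ⊗ ℂ ≃ V` (`TensorProduct.rid`), using `ω_t (artin w) = ‖w‖^t` (`unramifiedTwist_artin`) and
`‖w‖^s ‖w‖^t = ‖w‖^{s+t}`; the monodromies `N ⊗ 1 + 1 ⊗ 0` and `N` correspond.
Ref: Tate, Corvallis 1979, (3.4.5), (4.1.6); Deligne, Antwerp II (1973), §8.12. [folklore] -/
theorem isEquivalent_tprod_unramifiedTwist (hmul : IsFrobPow.mul (F := F))
    (huniq : IsFrobPow.unique (F := F)) (hex : exists_isFrobPow (F := F))
    (hns : WeilGroup.exists_subgroup_le_inertia_isOpen_of_continuous (F := F))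
    (r : WeilDeligneRep F ℂ V) (d : LocalArtinData F) (s t : ℂ) :
    WeilDeligneRep.IsEquivalent
      ((r.tprod (WeilDeligneRep.ofQuasiChar hns d (unramifiedTwist F t))).unramifiedTwist hmul huniq s)
      (r.unramifiedTwist hmul huniq (s + t)) := by
  refine ⟨{ toRepEquiv := Representation.Equiv.mk (TensorProduct.rid ℂ V) fun w =>
    TensorProduct.ext' fun v z => ?_, comm_N := TensorProduct.ext' fun v z => ?_ }⟩
  · simp only [LinearMap.comp_apply, LinearEquiv.coe_coe, WeilDeligneRep.unramifiedTwist_ρ_apply,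
      LinearMap.smul_apply, WeilDeligneRep.tprod_ρ_apply, TensorProduct.map_tmul,
      WeilDeligneRep.ofQuasiChar_ρ_apply, map_smul, TensorProduct.rid_tmul,
      unramifiedTwist_artin hmul huniq hex, normCpow_add hmul huniq, smul_smul]
    congr 1
    ring
  · simp only [LinearMap.comp_apply, WeilDeligneRep.unramifiedTwist_N, WeilDeligneRep.tprod_N,
      LinearMap.add_apply, TensorProduct.map_tmul, WeilDeligneRep.ofQuasiChar_N,
      LinearMap.zero_apply, TensorProduct.tmul_zero, add_zero, Module.End.one_apply,
      Representation.Equiv.toLinearMap_mk', LinearEquiv.coe_coe, TensorProduct.rid_tmul, map_smul]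

end Twist

end EpsilonTwist

/-! ### The discharge -/

section Main

variable {F : Type} [Field F] [ValuativeRel F] [TopologicalSpace F] [IsNonarchimedeanLocalField F]
  [MeasurableSpace F] [BorelSpace F]
  {V : Type} [AddCommGroup V] [Module ℂ V] [FiniteDimensional ℂ V]

open GaloisRepresentations in
/-- **Unramified twists shift `s`**: `ε((ρ, N) ⊗ (ω_t ∘ artin), s, ψ) = ε((ρ, N), s + t, ψ)` —
discharge of the named fact `epsilonWD_tprod_unramified`.
Proof: the `ε₀`-part by isomorphism invariance (`LocalEpsilonSystem.equiv`) applied to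
`(r ⊗ ω_t) ⊗ ‖·‖^s ≅ r ⊗ ‖·‖^{s+t}` (`EpsilonTwist.isEquivalent_tprod_unramifiedTwist`, using
`ω_t ∘ artin = ‖·‖^t`, i.e. `|artin w|_F = ‖w‖`); the determinant part by transporting
`V^I ⧸ (ker N)^I` along `V ≃ V ⊗ ℂ` (`EpsilonTwist.frobDetFactor_tprod_ofQuasiChar`) and
`q^{-s} ‖Φ‖^t = q^{-(s+t)}`.
Ref: Tate, *Number theoretic background* (Corvallis 1979), (3.4.5), (4.1.6); Deligne, Antwerp II
(1973), (5.5.3), §8.12; for `GL₁`: Kudla, *Tate's thesis* (2003), (3.28)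
`ε(s, ω ω_t, ψ) = ε(s + t, ω, ψ)`. [cite: TateCorvallis1979, (4.1.6)] -/
theorem epsilonWD_tprod_unramified_holds : epsilonWD_tprod_unramified (F := F) (V := V) := by
  intro hmul huniq hn hex hns 𝓔 ψ hψ μ _ r d s t
  simp only [epsilonWD]
  congr 1
  · exact 𝓔.equiv F ψ μ _ _ hψ
      (EpsilonTwist.isEquivalent_tprod_unramifiedTwist hmul huniq hex hns r d s t)
  · rw [EpsilonTwist.frobDetFactor_tprod_ofQuasiChar hn hex hns r d
        (isUnramified_unramifiedTwist t) s, WeilDeligneRep.frobDetFactor, EpsilonTwist.unramifiedTwist_artin hmul huniq hex,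
      EpsilonTwist.qpow_mul_normCpow_geomFrob hmul huniq hex]

end Main

end Literature.NumberTheory.Automorphic
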